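import Mathlib

/-!
# Stub H6 for line `Sketch` of crux `BorderHalfDimensionDesigns` (stmt-MatrixMultiplication-18360)

Dimension count: if the `|ι|` indicator functions of the points of `ι` all lie in the `ℂ`-span of
`|κ|` given functions `G k : ι → ℂ`, then `|ι| ≤ |κ|`.  Pure linear algebra: the linear map
`c ↦ (i' ↦ ∑ k, c k * G k i')`, i.e. `Matrix.vecMulLinear (Matrix.of G)`, hits every standard basis
vector `Pi.single i 1`, hence is surjective, so `finrank (ι → ℂ) ≤ finrank (κ → ℂ)`.
-/

set_option linter.dupNamespace false

namespace Summit.MatrixMultiplication.MatrixMultiplication.Theorems.BorderHalfDimensionDesigns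

/-- STUB H6: indicators in a span of `|κ|` functions force `|ι| ≤ |κ|`. -/
theorem stub_card_le_of_indicator_mem_span {ι κ : Type*} [Fintype ι] [DecidableEq ι] [Fintype κ]
    (G : κ → ι → ℂ)
    (h : ∀ i : ι, ∃ c : κ → ℂ, ∀ i' : ι, (if i' = i then (1 : ℂ) else 0) = ∑ k, c k * G k i') :
    Fintype.card ι ≤ Fintype.card κ := by
  set T : (κ → ℂ) →ₗ[ℂ] (ι → ℂ) := Matrix.vecMulLinear (Matrix.of G) with hT
  have hsingle : ∀ i : ι, Pi.single i (1 : ℂ) ∈ LinearMap.range T := by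
    intro i
    obtain ⟨c, hc⟩ := h i
    refine ⟨c, ?_⟩
    funext i'
    rw [Pi.single_apply, hc i', hT, Matrix.vecMulLinear_apply]
    simp [Matrix.vecMul, dotProduct]
  have hsurj : Function.Surjective T := by
    rw [← LinearMap.range_eq_top, eq_top_iff, ← (Pi.basisFun ℂ ι).span_eq, Submodule.span_le]
    rintro _ ⟨i, rfl⟩
    rw [Pi.basisFun_apply]
    exact hsingle i
  have hle := LinearMap.finrank_le_finrank_of_surjective hsurj
  simpa only [Module.finrank_fintype_fun_eq_card] using hle

end Summit.MatrixMultiplication.MatrixMultiplication.Theorems.BorderHalfDimensionDesigns
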